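import Mathlib
import HarnessLib
import Summits.HubbardSuperconductivity.HubbardSuperconductivity.Theorems.KLProgrammeKLRegimeEnginePairLadderTowerCompose

/-!
# Route `KLProgramme` — crux K3, ENGINE child gen 5 (stmt-HubbardSuperconductivity-19918 `KLRegimeEngineV14`), stub `stub_engine_step_values`,
# conjunct (E2-v9) at `1 ≤ n`: the tower composition with the straddle relations in FORWARD form — `pairLadderStepAtV9_of_wickTower_fwd`

Cell gate-hubbard-kl, seat hubbard-kl-k3c1-p1 (g5), technique «composed-map remainder propagation».  Companion of
`…EnginePairLadderTowerCompose` (p494435).  There the two straddle relations were read in the INVERTED form of p1 g8's draft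
(`𝒞_j ≈ 𝒞^W_j·N′`, `(1 − diag μ·𝒞^W_j)·N′ = 1`).  The Wick smearing `𝒲 = e^{Δ_D}𝒱` produces them natively the other way round — the Wick pair
array is the PLAIN one resummed over the straddling pairs (soft `≤ Λ_j` line, hard `> Λ_j` partner: the 1PR trees of `𝒱₆, 𝒱₈, …` closed by
soft lines) plus a non-chain rest: `𝒞^W_j = F_{−b_j}(𝒞_j) + R_j`, i.e. `(1 − diag b_j·𝒞̂_j)·M_j = 1`, `‖𝒞̂^W_j − 𝒞̂_j·M_j‖ ≤ R_j`.  This file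
composes THAT form directly (no double dressing of `R_{n−1}`; the scale-`n` relation is inverted EXACTLY by `kltc_inverse_map`):
* §1 **`kltc_tower_compose_fwd`** (generic finite carrier, Neumann regime): `X ≈ C₀·M′` [(1 − diag b′C₀)M′ = 1, err `R′ ≤ r′`], `Y ≈ X·N`
  [(1 + diag w₁X)N = 1, err `E_a`], `Y ≈ C₁·M` [(1 − diag bC₁)M = 1, err `E_R ≤ e_R`] ⟹ `∃ N₃` two-sided inverse of `1 + diag(w₁ + b − b′)·C₀` with
  `‖C₁ − C₀N₃‖ ≤ FT_σ(E₂)` entrywise, `E₂ ≥ E_R + E₁`, `E₁ ≥ E_a + FT_ρ(R′)` (`ρ ≥ |w₁|`, `σ ≥ |b|`, `τ ≥ |b′|`; weighted four-term forms of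
  `klell_kernel_perturbation`); smallness `m·Στ ≤ 1/3`, `((3/2)m + r′)·Σρ ≤ 1/3`, `((9/4)m + e₁ + e_R)·Σσ ≤ 1/3`.
* §2 **`pairLadderStepAtV9_of_wickTower_fwd`** (model, BY NAME on `…SplitEngineV9`): the same data per pair class with ball-restricted `X, Y`,
  errors on `klBall²`, the composite weight's two mass clauses and one closed-form budget inequality ⟹ `PairLadderStepAtV9 … n`.
Exact algebra + two kernel perturbations; nothing about the model is asserted.  0 kit.
-/

noncomputable section

namespace Summit.HubbardSuperconductivity.HubbardSuperconductivity.Theorems.KLRegimeSplit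

set_option linter.dupNamespace false -- summit = problem name (single-conjunct summit), D-0017

open Finset Matrix Literature.MathematicalPhysics.QuantumLattice Literature.Probability.LatticeModels
open Summit.HubbardSuperconductivity.HubbardSuperconductivity.Theorems.KLProgrammeCooperResummation
open Summit.HubbardSuperconductivity.HubbardSuperconductivity.Theorems.KLProgrammeLegKernels

/-! ## §1 The forward-form composition -/

section Compose

variable {S : Type*} [Fintype S] [DecidableEq S] [Nonempty S]

/-- **Composed-map remainder propagation, straddle relations in forward form.**  `C₀` (plain, scale `n−1`, `|C₀| ≤ m`), `C₁` (plain, scale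
`n`), `X`, `Y` (Wick arrays of scales `n−1`, `n`); complex weights `b′` (straddle `n−1`), `w₁` (Wick step), `b` (straddle `n`) under majorant
profiles `τ, ρ, σ`; right inverses `M′` of `1 − diag b′·C₀`, `N` of `1 + diag w₁·X`, `M` of `1 − diag b·C₁`; entrywise error majorants
`‖X − C₀·M′‖ ≤ R′ ≤ r′`, `‖Y − X·N‖ ≤ E_a`, `‖Y − C₁·M‖ ≤ E_R ≤ e_R`; intermediate majorants `E₁ ≥ E_a + FT_ρ(R′)` (`≤ e₁`) and `E₂ ≥ E_R + E₁`.
THEN `1 + diag(w₁ + b − b′)·C₀` has a two-sided inverse `N₃` and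
`‖C₁ − C₀·N₃‖(x,y) ≤ E₂(x,y) + (3/2)(9/4 m)·Σ_b E₂(x,b)σ_b + (3/2)((9/4)m + e₁ + e_R)·Σ_a σ_a E₂(a,y) + (9/4)((9/4)m + e₁ + e_R)(9/4 m)·Σ_aΣ_b σ_a E₂(a,b)σ_b`. -/
theorem kltc_tower_compose_fwd (C₀ C₁ X Y M' N M : Matrix S S ℂ) (b' w₁ b : S → ℂ) (τ ρ σ : S → ℝ) (R' Ea ER E₁ E₂ : S → S → ℝ)
    {m r' eR e₁ : ℝ} (hm : 0 ≤ m) (hr' : 0 ≤ r') (heR : 0 ≤ eR) (he₁ : 0 ≤ e₁)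
    (hC₀ : ∀ x y, ‖C₀ x y‖ ≤ m) (hτ : ∀ a, ‖b' a‖ ≤ τ a) (hρ : ∀ a, ‖w₁ a‖ ≤ ρ a) (hσ : ∀ a, ‖b a‖ ≤ σ a)
    (hM' : (1 - diagonal b' * C₀) * M' = 1) (hR' : ∀ x y, ‖X x y - (C₀ * M') x y‖ ≤ R' x y) (hR'e : ∀ x y, R' x y ≤ r')
    (hN : (1 + diagonal w₁ * X) * N = 1) (hEa : ∀ x y, ‖Y x y - (X * N) x y‖ ≤ Ea x y)
    (hM : (1 - diagonal b * C₁) * M = 1) (hER : ∀ x y, ‖Y x y - (C₁ * M) x y‖ ≤ ER x y) (hERe : ∀ x y, ER x y ≤ eR)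
    (hE₁ : ∀ x y, Ea x y + (R' x y + 3 / 2 * (3 / 2 * m) * ∑ t, R' x t * ρ t + 3 / 2 * (3 / 2 * m + r') * ∑ a, ρ a * R' a y +
        9 / 4 * (3 / 2 * m + r') * (3 / 2 * m) * ∑ a, ∑ t, ρ a * R' a t * ρ t) ≤ E₁ x y)
    (hE₁e : ∀ x y, E₁ x y ≤ e₁) (hE₂ : ∀ x y, ER x y + E₁ x y ≤ E₂ x y)
    (hsm₀ : m * ∑ a, τ a ≤ 1 / 3) (hsm₁ : (3 / 2 * m + r') * ∑ a, ρ a ≤ 1 / 3)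
    (hsm₂ : (9 / 4 * m + e₁ + eR) * ∑ a, σ a ≤ 1 / 3) :
    ∃ N₃ : Matrix S S ℂ, (1 + diagonal (fun a => w₁ a + b a - b' a) * C₀) * N₃ = 1 ∧
      N₃ * (1 + diagonal (fun a => w₁ a + b a - b' a) * C₀) = 1 ∧
      ∀ x y, ‖C₁ x y - (C₀ * N₃) x y‖ ≤ E₂ x y + 3 / 2 * (9 / 4 * m) * ∑ t, E₂ x t * σ t +
        3 / 2 * (9 / 4 * m + e₁ + eR) * ∑ a, σ a * E₂ a y +
          9 / 4 * (9 / 4 * m + e₁ + eR) * (9 / 4 * m) * ∑ a, ∑ t, σ a * E₂ a t * σ t := by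
  -- nonnegativity bookkeeping
  have hR'0 : ∀ x y, 0 ≤ R' x y := fun x y => (norm_nonneg _).trans (hR' x y)
  have hEa0 : ∀ x y, 0 ≤ Ea x y := fun x y => (norm_nonneg _).trans (hEa x y)
  have hER0 : ∀ x y, 0 ≤ ER x y := fun x y => (norm_nonneg _).trans (hER x y)
  have hτ0 : ∀ a, 0 ≤ τ a := fun a => (norm_nonneg _).trans (hτ a)
  have hρ0 : ∀ a, 0 ≤ ρ a := fun a => (norm_nonneg _).trans (hρ a)
  have hσ0 : ∀ a, 0 ≤ σ a := fun a => (norm_nonneg _).trans (hσ a)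
  have hE₁0 : ∀ x y, 0 ≤ E₁ x y := by
    intro x y
    refine le_trans ?_ (hE₁ x y)
    have h1 : 0 ≤ ∑ t, R' x t * ρ t := sum_nonneg fun t _ => mul_nonneg (hR'0 x t) (hρ0 t)
    have h2 : 0 ≤ ∑ a, ρ a * R' a y := sum_nonneg fun a _ => mul_nonneg (hρ0 a) (hR'0 a y)
    have h3 : 0 ≤ ∑ a, ∑ t, ρ a * R' a t * ρ t :=
      sum_nonneg fun a _ => sum_nonneg fun t _ => mul_nonneg (mul_nonneg (hρ0 a) (hR'0 a t)) (hρ0 t)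
    have := hEa0 x y; have := hR'0 x y
    positivity
  have hE₂0 : ∀ x y, 0 ≤ E₂ x y := fun x y => le_trans (add_nonneg (hER0 x y) (hE₁0 x y)) (hE₂ x y)
  -- Step 1: `X₀ := C₀·M′ = F_{−b′}(C₀)`, entry bound `(3/2)m`
  set ν' : S → ℂ := fun a => -b' a with hν'_def
  have hν'n : ∀ a, ‖ν' a‖ = ‖b' a‖ := fun a => by rw [hν'_def, norm_neg]
  have hZτ : m * ∑ a, ‖ν' a‖ ≤ 1 / 3 :=
    (mul_le_mul_of_nonneg_left (sum_le_sum fun a _ => (hν'n a).le.trans (hτ a)) hm).trans hsm₀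
  have hdν' : diagonal ν' = -diagonal b' := (diagonal_neg b').symm
  have hM'ν : (1 + diagonal ν' * C₀) * M' = 1 := by rw [hdν', neg_mul, ← sub_eq_add_neg]; exact hM'
  obtain ⟨M₁, _, hM₁1, hM₁2, -, -, -, -, -, hC₀M₁, -, -⟩ := klcrs_single_slice ν' hm C₀ hC₀ hZτ
  have hMM : M' = M₁ := by
    calc M' = M₁ * (1 + diagonal ν' * C₀) * M' := by rw [hM₁2, one_mul]
      _ = M₁ := by rw [mul_assoc, hM'ν, mul_one]
  set X₀ : Matrix S S ℂ := C₀ * M' with hX₀_def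
  have hm₀ : 0 ≤ 3 / 2 * m := by positivity
  have hX₀b : ∀ x y, ‖X₀ x y‖ ≤ 3 / 2 * m := by intro x y; rw [hX₀_def, hMM]; exact hC₀M₁ x y
  have hXb : ∀ x y, ‖X x y‖ ≤ 3 / 2 * m + r' := by
    intro x y
    have h1 : ‖X x y‖ ≤ ‖X₀ x y‖ + ‖X x y - X₀ x y‖ := by
      calc ‖X x y‖ = ‖X₀ x y + (X x y - X₀ x y)‖ := by rw [add_sub_cancel]
        _ ≤ ‖X₀ x y‖ + ‖X x y - X₀ x y‖ := norm_add_le _ _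
    linarith [hX₀b x y, hR' x y, hR'e x y]
  -- Step 2: resum `X₀` and `X` at `w₁`, compare
  have hmX : 0 ≤ 3 / 2 * m + r' := by positivity
  have hZρ_le : ∑ a, ‖w₁ a‖ ≤ ∑ a, ρ a := sum_le_sum fun a _ => hρ a
  have hZρK : (3 / 2 * m + r') * ∑ a, ‖w₁ a‖ ≤ 1 / 3 := (mul_le_mul_of_nonneg_left hZρ_le hmX).trans hsm₁
  have hZρC : 3 / 2 * m * ∑ a, ‖w₁ a‖ ≤ 1 / 3 :=
    (mul_le_mul_of_nonneg_right (by linarith : 3 / 2 * m ≤ 3 / 2 * m + r') (sum_nonneg fun a _ => norm_nonneg _)).trans hZρK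
  obtain ⟨N₀, _, hN₀1, -, -, -, -, -, -, hX₀N₀, -, -⟩ := klcrs_single_slice w₁ hm₀ X₀ hX₀b hZρC
  have hTX := (klcrs_single_slice_ladder_hasSum w₁ hmX X hXb hZρK N hN).2
  have hTX₀ := (klcrs_single_slice_ladder_hasSum w₁ hm₀ X₀ hX₀b hZρC N₀ hN₀1).2
  have hstep2 : ∀ x y, ‖(X * N) x y - (X₀ * N₀) x y‖ ≤ R' x y + 3 / 2 * (3 / 2 * m) * ∑ t, R' x t * ρ t +
      3 / 2 * (3 / 2 * m + r') * ∑ a, ρ a * R' a y + 9 / 4 * (3 / 2 * m + r') * (3 / 2 * m) * ∑ a, ∑ t, ρ a * R' a t * ρ t := by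
    intro x y
    have h := klell_kernel_perturbation X X₀ w₁ hm₀ hmX hX₀b hXb hZρC hZρK (X * N) (X₀ * N₀) hTX hTX₀ x y
    have hEnt : ∀ a t, ‖(X - X₀) a t‖ ≤ R' a t := fun a t => by rw [Matrix.sub_apply]; exact hR' a t
    have h2 : ∑ t, ‖(X - X₀) x t‖ * ‖w₁ t‖ ≤ ∑ t, R' x t * ρ t :=
      sum_le_sum fun t _ => mul_le_mul (hEnt x t) (hρ t) (norm_nonneg _) (hR'0 x t)
    have h3 : ∑ a, ‖w₁ a‖ * ‖(X - X₀) a y‖ ≤ ∑ a, ρ a * R' a y :=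
      sum_le_sum fun a _ => mul_le_mul (hρ a) (hEnt a y) (norm_nonneg _) (hρ0 a)
    have h4 : ∑ a, ∑ t, ‖w₁ a‖ * ‖(X - X₀) a t‖ * ‖w₁ t‖ ≤ ∑ a, ∑ t, ρ a * R' a t * ρ t :=
      sum_le_sum fun a _ => sum_le_sum fun t _ =>
        mul_le_mul (mul_le_mul (hρ a) (hEnt a t) (norm_nonneg _) (hρ0 a)) (hρ t) (norm_nonneg _)
          (mul_nonneg (hρ0 a) (hR'0 a t))
    have e2 : 3 / 2 * (3 / 2 * m) * ∑ t, ‖(X - X₀) x t‖ * ‖w₁ t‖ ≤ 3 / 2 * (3 / 2 * m) * ∑ t, R' x t * ρ t :=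
      mul_le_mul_of_nonneg_left h2 (by positivity)
    have e3 : 3 / 2 * (3 / 2 * m + r') * ∑ a, ‖w₁ a‖ * ‖(X - X₀) a y‖ ≤ 3 / 2 * (3 / 2 * m + r') * ∑ a, ρ a * R' a y :=
      mul_le_mul_of_nonneg_left h3 (by positivity)
    have e4 : 9 / 4 * (3 / 2 * m + r') * (3 / 2 * m) * ∑ a, ∑ t, ‖w₁ a‖ * ‖(X - X₀) a t‖ * ‖w₁ t‖ ≤
        9 / 4 * (3 / 2 * m + r') * (3 / 2 * m) * ∑ a, ∑ t, ρ a * R' a t * ρ t := mul_le_mul_of_nonneg_left h4 (by positivity)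
    linarith [hEnt x y]
  -- `Y₀ := X₀·N₀ = C₀·N₂`, `(1 + diag(ν′ + w₁)·C₀)·N₂ = 1`
  have hN₂ : (1 + (diagonal ν' + diagonal w₁) * C₀) * (M' * N₀) = 1 := klli_compose C₀ (diagonal ν') (diagonal w₁) M' N₀ hM'ν hN₀1
  set Y₀ : Matrix S S ℂ := X₀ * N₀ with hY₀_def
  have hY₀eq : Y₀ = C₀ * (M' * N₀) := by rw [hY₀_def, hX₀_def, Matrix.mul_assoc]
  have hmY₀ : 0 ≤ 9 / 4 * m := by positivity
  have hY₀b : ∀ x y, ‖Y₀ x y‖ ≤ 9 / 4 * m := by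
    intro x y; have := hX₀N₀ x y; linarith
  have hYY₀ : ∀ x y, ‖Y x y - Y₀ x y‖ ≤ E₁ x y := by
    intro x y
    have h1 : ‖Y x y - Y₀ x y‖ ≤ ‖Y x y - (X * N) x y‖ + ‖(X * N) x y - Y₀ x y‖ := by
      calc ‖Y x y - Y₀ x y‖ = ‖(Y x y - (X * N) x y) + ((X * N) x y - Y₀ x y)‖ := by rw [sub_add_sub_cancel]
        _ ≤ ‖Y x y - (X * N) x y‖ + ‖(X * N) x y - Y₀ x y‖ := norm_add_le _ _
    linarith [hEa x y, hstep2 x y, hE₁ x y]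
  -- Step 3: `K := C₁·M = F_{−b}(C₁)`; `C₁ = F_b(K)` exactly
  set K : Matrix S S ℂ := C₁ * M with hK_def
  obtain ⟨hM₂, hKM₂⟩ := kltc_inverse_map C₁ (diagonal b) M hM
  -- hM₂ : (1 + diagonal b * K) * (1 - diagonal b * C₁) = 1 ; hKM₂ : K * (1 - diagonal b * C₁) = C₁
  have hmK : 0 ≤ 9 / 4 * m + e₁ + eR := by positivity
  have hKb : ∀ x y, ‖K x y‖ ≤ 9 / 4 * m + e₁ + eR := by
    intro x y
    have h1 : ‖K x y‖ ≤ ‖Y₀ x y‖ + ‖Y x y - Y₀ x y‖ + ‖Y x y - K x y‖ := by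
      calc ‖K x y‖ = ‖Y₀ x y + (Y x y - Y₀ x y) - (Y x y - K x y)‖ := by congr 1; ring
        _ ≤ ‖Y₀ x y + (Y x y - Y₀ x y)‖ + ‖Y x y - K x y‖ := norm_sub_le _ _
        _ ≤ ‖Y₀ x y‖ + ‖Y x y - Y₀ x y‖ + ‖Y x y - K x y‖ := by linarith [norm_add_le (Y₀ x y) (Y x y - Y₀ x y)]
    linarith [hY₀b x y, hYY₀ x y, hE₁e x y, hER x y, hERe x y]
  have hZσ_le : ∑ a, ‖b a‖ ≤ ∑ a, σ a := sum_le_sum fun a _ => hσ a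
  have hZσK : (9 / 4 * m + e₁ + eR) * ∑ a, ‖b a‖ ≤ 1 / 3 := (mul_le_mul_of_nonneg_left hZσ_le hmK).trans hsm₂
  have hZσC : 9 / 4 * m * ∑ a, ‖b a‖ ≤ 1 / 3 :=
    (mul_le_mul_of_nonneg_right (by linarith : 9 / 4 * m ≤ 9 / 4 * m + e₁ + eR) (sum_nonneg fun a _ => norm_nonneg _)).trans hZσK
  obtain ⟨N₄, _, hN₄1, -, -, -, -, -, -, -, -, -⟩ := klcrs_single_slice b hmY₀ Y₀ hY₀b hZσC
  have hTK := (klcrs_single_slice_ladder_hasSum b hmK K hKb hZσK (1 - diagonal b * C₁) hM₂).2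
  have hTY₀ := (klcrs_single_slice_ladder_hasSum b hmY₀ Y₀ hY₀b hZσC N₄ hN₄1).2
  have hstep3 : ∀ x y, ‖C₁ x y - (Y₀ * N₄) x y‖ ≤ E₂ x y + 3 / 2 * (9 / 4 * m) * ∑ t, E₂ x t * σ t +
      3 / 2 * (9 / 4 * m + e₁ + eR) * ∑ a, σ a * E₂ a y +
        9 / 4 * (9 / 4 * m + e₁ + eR) * (9 / 4 * m) * ∑ a, ∑ t, σ a * E₂ a t * σ t := by
    intro x y
    have h := klell_kernel_perturbation K Y₀ b hmY₀ hmK hY₀b hKb hZσC hZσK (K * (1 - diagonal b * C₁)) (Y₀ * N₄) hTK hTY₀ x y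
    rw [hKM₂] at h
    have hEnt : ∀ a t, ‖(K - Y₀) a t‖ ≤ E₂ a t := by
      intro a t
      rw [Matrix.sub_apply]
      have h1 : ‖K a t - Y₀ a t‖ ≤ ‖Y a t - K a t‖ + ‖Y a t - Y₀ a t‖ := by
        calc ‖K a t - Y₀ a t‖ = ‖(Y a t - Y₀ a t) - (Y a t - K a t)‖ := by congr 1; ring
          _ ≤ ‖Y a t - Y₀ a t‖ + ‖Y a t - K a t‖ := norm_sub_le _ _
          _ = ‖Y a t - K a t‖ + ‖Y a t - Y₀ a t‖ := add_comm _ _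
      linarith [hER a t, hYY₀ a t, hE₂ a t]
    have h2 : ∑ t, ‖(K - Y₀) x t‖ * ‖b t‖ ≤ ∑ t, E₂ x t * σ t :=
      sum_le_sum fun t _ => mul_le_mul (hEnt x t) (hσ t) (norm_nonneg _) (hE₂0 x t)
    have h3 : ∑ a, ‖b a‖ * ‖(K - Y₀) a y‖ ≤ ∑ a, σ a * E₂ a y :=
      sum_le_sum fun a _ => mul_le_mul (hσ a) (hEnt a y) (norm_nonneg _) (hσ0 a)
    have h4 : ∑ a, ∑ t, ‖b a‖ * ‖(K - Y₀) a t‖ * ‖b t‖ ≤ ∑ a, ∑ t, σ a * E₂ a t * σ t :=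
      sum_le_sum fun a _ => sum_le_sum fun t _ =>
        mul_le_mul (mul_le_mul (hσ a) (hEnt a t) (norm_nonneg _) (hσ0 a)) (hσ t) (norm_nonneg _)
          (mul_nonneg (hσ0 a) (hE₂0 a t))
    have e2 : 3 / 2 * (9 / 4 * m) * ∑ t, ‖(K - Y₀) x t‖ * ‖b t‖ ≤ 3 / 2 * (9 / 4 * m) * ∑ t, E₂ x t * σ t :=
      mul_le_mul_of_nonneg_left h2 (by positivity)
    have e3 : 3 / 2 * (9 / 4 * m + e₁ + eR) * ∑ a, ‖b a‖ * ‖(K - Y₀) a y‖ ≤ 3 / 2 * (9 / 4 * m + e₁ + eR) * ∑ a, σ a * E₂ a y :=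
      mul_le_mul_of_nonneg_left h3 (by positivity)
    have e4 : 9 / 4 * (9 / 4 * m + e₁ + eR) * (9 / 4 * m) * ∑ a, ∑ t, ‖b a‖ * ‖(K - Y₀) a t‖ * ‖b t‖ ≤
        9 / 4 * (9 / 4 * m + e₁ + eR) * (9 / 4 * m) * ∑ a, ∑ t, σ a * E₂ a t * σ t := mul_le_mul_of_nonneg_left h4 (by positivity)
    linarith [hEnt x y]
  -- Step 4: compose `F_b ∘ F_{w₁ − b′}`
  have hN₃ : (1 + (diagonal ν' + diagonal w₁ + diagonal b) * C₀) * (M' * N₀ * N₄) = 1 := by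
    have h := klli_compose C₀ (diagonal ν' + diagonal w₁) (diagonal b) (M' * N₀) N₄ hN₂ (by rw [← hY₀eq]; exact hN₄1)
    rw [Matrix.mul_assoc] at h ⊢
    exact h
  have hdw : diagonal ν' + diagonal w₁ + diagonal b = diagonal (fun a => w₁ a + b a - b' a) := by
    rw [diagonal_add, diagonal_add]
    exact congrArg diagonal (funext fun a => by simp only [hν'_def]; ring)
  rw [hdw] at hN₃
  refine ⟨M' * N₀ * N₄, hN₃, mul_eq_one_comm.mp hN₃, fun x y => ?_⟩
  have hrew : C₀ * (M' * N₀ * N₄) = Y₀ * N₄ := by rw [hY₀eq]; simp only [Matrix.mul_assoc]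
  rw [hrew]
  exact hstep3 x y

end Compose

/-! ## §2 Model: (E2-v9) at `1 ≤ n` from the Wick tower with forward straddle relations, BY NAME -/

section Model

variable (L M : ℕ) [NeZero L] [NeZero M]

/-- **(E2-v9) `PairLadderStepAtV9 … n` (`1 ≤ n`) from the private Wick tower, straddle relations in FORWARD form.**  Per pair class `Qm`:
ball-restricted Wick arrays `X` (scale `n−1`), `Y` (scale `n`) — any matrices vanishing off `klBall²`; REAL weights `b′` (straddle `n−1`),
`w₁` (Wick step `n`), `b` (straddle `n`); right inverses `M′` of `1 − diag b′·𝒞̂_{n−1}`, `N` of `1 + diag w₁·X`, `M` of `1 − diag b·𝒞̂_n`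
(`𝒞̂_j = klPairArray … j Qm`); nonnegative error majorants with `‖X − 𝒞̂_{n−1}·M′‖ ≤ R′ ≤ r′`, `‖Y − X·N‖ ≤ E_a`, `‖Y − 𝒞̂_n·M‖ ≤ E_R ≤ e_R`
on `klBall²`; intermediate majorants `E₁ ≥ E_a + FT_{|w₁|}(R′)` (`≤ e₁`), `E₂ ≥ E_R + E₁`; smallness `m·Σ|b′| ≤ 1/3`,
`((3/2)m + r′)·Σ|w₁| ≤ 1/3`, `((9/4)m + e₁ + e_R)·Σ|b| ≤ 1/3`; the two mass clauses of the COMPOSITE weight `w := w₁ + b − b′`; and the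
closed-form budget `FT_{|b|}(E₂) ≤ drivePBar + eremBar + thermalBar + legDressBarQ·countT + (X)` at the external entries. -/
theorem pairLadderStepAtV9_of_wickTower_fwd {G : GeoConsts} {P : SplitConsts} {Q : EngConsts} {β U μ : ℝ} {K₀ : TrigPolyC4v} {n : ℕ}
    {m : ℝ} (hn : 1 ≤ n) (hm : 0 ≤ m) (hC₀ : ∀ Qm s t, ‖klPairArray L M β U μ K₀ (n - 1) Qm s t‖ ≤ m)
    (htower : ∀ Qm : TorusSite 2 L, IsPairClassAt L Qm n →
      ∃ (X Y M' N M₀ : Matrix (TorusSite 2 L) (TorusSite 2 L) ℂ) (b' w₁ b : TorusSite 2 L → ℝ)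
        (R' Ea ER E₁ E₂ : TorusSite 2 L → TorusSite 2 L → ℝ) (r' eR e₁ : ℝ),
        0 ≤ r' ∧ 0 ≤ eR ∧ 0 ≤ e₁ ∧
        (∀ x y, ¬(x ∈ klBall L μ K₀ ∧ y ∈ klBall L μ K₀) → X x y = 0) ∧
        (∀ x y, ¬(x ∈ klBall L μ K₀ ∧ y ∈ klBall L μ K₀) → Y x y = 0) ∧
        (∀ x y, 0 ≤ R' x y) ∧ (∀ x y, 0 ≤ Ea x y) ∧ (∀ x y, 0 ≤ ER x y) ∧
        (1 - diagonal (fun p => (b' p : ℂ)) * klPairArray L M β U μ K₀ (n - 1) Qm) * M' = 1 ∧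
        (∀ k ∈ klBall L μ K₀, ∀ k' ∈ klBall L μ K₀, ‖X k k' - (klPairArray L M β U μ K₀ (n - 1) Qm * M') k k'‖ ≤ R' k k') ∧
        (∀ x y, R' x y ≤ r') ∧
        (1 + diagonal (fun p => (w₁ p : ℂ)) * X) * N = 1 ∧
        (∀ k ∈ klBall L μ K₀, ∀ k' ∈ klBall L μ K₀, ‖Y k k' - (X * N) k k'‖ ≤ Ea k k') ∧
        (1 - diagonal (fun p => (b p : ℂ)) * klPairArray L M β U μ K₀ n Qm) * M₀ = 1 ∧
        (∀ k ∈ klBall L μ K₀, ∀ k' ∈ klBall L μ K₀, ‖Y k k' - (klPairArray L M β U μ K₀ n Qm * M₀) k k'‖ ≤ ER k k') ∧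
        (∀ x y, ER x y ≤ eR) ∧
        (∀ x y, Ea x y + (R' x y + 3 / 2 * (3 / 2 * m) * ∑ t, R' x t * |w₁ t| + 3 / 2 * (3 / 2 * m + r') * ∑ a, |w₁ a| * R' a y +
            9 / 4 * (3 / 2 * m + r') * (3 / 2 * m) * ∑ a, ∑ t, |w₁ a| * R' a t * |w₁ t|) ≤ E₁ x y) ∧
        (∀ x y, E₁ x y ≤ e₁) ∧ (∀ x y, ER x y + E₁ x y ≤ E₂ x y) ∧
        m * ∑ a, |b' a| ≤ 1 / 3 ∧ (3 / 2 * m + r') * ∑ a, |w₁ a| ≤ 1 / 3 ∧ (9 / 4 * m + e₁ + eR) * ∑ a, |b a| ≤ 1 / 3 ∧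
        (∑ p, |w₁ p + b p - b' p| ≤ G.bhi) ∧
        (∑ p, (|w₁ p + b p - b' p| - (w₁ p + b p - b' p)) ≤ 2 * klEdge G n (klTorusNorm L Qm)) ∧
        (∀ k ∈ klBall L μ K₀, ∀ k' ∈ klBall L μ K₀,
          E₂ k k' + 3 / 2 * (9 / 4 * m) * ∑ t, E₂ k t * |b t| + 3 / 2 * (9 / 4 * m + e₁ + eR) * ∑ a, |b a| * E₂ a k' +
              9 / 4 * (9 / 4 * m + e₁ + eR) * (9 / 4 * m) * ∑ a, ∑ t, |b a| * E₂ a t * |b t| ≤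
            drivePBar G P U (n - 1) + eremBar G P Q U β L (n - 1) + thermalBar G P U β n +
              legDressBarQ G P Q U n (legSliceCountT L β μ K₀ n ![k', Qm - k', Qm - k, k]) +
              (P.Klam * U) ^ 2 * (G.phGain n (klTorusNorm L (k - k')) + G.phGain n (klTorusNorm L (k + k' - Qm))))) :
    PairLadderStepAtV9 L M G P Q β U μ K₀ n := by
  refine ⟨fun h0 => absurd h0 (by omega), fun _ Qm hQm => ?_⟩
  obtain ⟨X, Y, M', N, M₀, b', w₁, b, R', Ea, ER, E₁, E₂, r', eR, e₁, hr', heR, he₁, hX0, hY0, hR'0, hEa0, hER0, hM', hR', hR'e, hN,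
    hEa, hM₀, hER, hERe, hE₁, hE₁e, hE₂, hsm₀, hsm₁, hsm₂, hmass, hneg, hbud⟩ := htower Qm hQm
  set B := klBall L μ K₀ with hB_def
  set C₀ : Matrix (TorusSite 2 L) (TorusSite 2 L) ℂ := klPairArray L M β U μ K₀ (n - 1) Qm with hC₀_def
  set C₁ : Matrix (TorusSite 2 L) (TorusSite 2 L) ℂ := klPairArray L M β U μ K₀ n Qm with hC₁_def
  have hC_on : ∀ j, ∀ k ∈ B, ∀ k' ∈ B, klPairArray L M β U μ K₀ j Qm k k' = klPairAmplitude L M β U μ K₀ j Qm k k' := by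
    intro j k hk k' hk'
    simp only [klPairArray, Matrix.of_apply, hB_def] at hk hk' ⊢
    rw [if_pos ⟨hk, hk'⟩]
  have hC_off : ∀ j x y, ¬(x ∈ B ∧ y ∈ B) → klPairArray L M β U μ K₀ j Qm x y = 0 := by
    intro j x y hxy
    simp only [klPairArray, Matrix.of_apply, hB_def] at hxy ⊢
    rw [if_neg hxy]
  -- vanishing of the resummed arrays off the ball
  have hM'alt : (1 + (-diagonal (fun p => (b' p : ℂ))) * C₀) * M' = 1 := by
    rw [neg_mul, ← sub_eq_add_neg]; exact hM'
  have hM₀alt : (1 + (-diagonal (fun p => (b p : ℂ))) * C₁) * M₀ = 1 := by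
    rw [neg_mul, ← sub_eq_add_neg]; exact hM₀
  have hC₀M'0 : ∀ x y, ¬(x ∈ B ∧ y ∈ B) → (C₀ * M') x y = 0 := fun x y hxy =>
    kltc_mul_rightInv_apply_eq_zero C₀ _ M' B hM'alt (hC_off (n - 1)) hxy
  have hXN0 : ∀ x y, ¬(x ∈ B ∧ y ∈ B) → (X * N) x y = 0 := fun x y hxy =>
    kltc_mul_rightInv_apply_eq_zero X _ N B hN hX0 hxy
  have hC₁M₀0 : ∀ x y, ¬(x ∈ B ∧ y ∈ B) → (C₁ * M₀) x y = 0 := fun x y hxy =>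
    kltc_mul_rightInv_apply_eq_zero C₁ _ M₀ B hM₀alt (hC_off n) hxy
  -- global error bounds
  have gR' : ∀ x y, ‖X x y - (C₀ * M') x y‖ ≤ R' x y := by
    intro x y
    by_cases hxy : x ∈ B ∧ y ∈ B
    · exact hR' x hxy.1 y hxy.2
    · rw [hX0 x y hxy, hC₀M'0 x y hxy, sub_zero, norm_zero]; exact hR'0 x y
  have gEa : ∀ x y, ‖Y x y - (X * N) x y‖ ≤ Ea x y := by
    intro x y
    by_cases hxy : x ∈ B ∧ y ∈ B
    · exact hEa x hxy.1 y hxy.2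
    · rw [hY0 x y hxy, hXN0 x y hxy, sub_zero, norm_zero]; exact hEa0 x y
  have gER : ∀ x y, ‖Y x y - (C₁ * M₀) x y‖ ≤ ER x y := by
    intro x y
    by_cases hxy : x ∈ B ∧ y ∈ B
    · exact hER x hxy.1 y hxy.2
    · rw [hY0 x y hxy, hC₁M₀0 x y hxy, sub_zero, norm_zero]; exact hER0 x y
  -- norms of the real weights
  have hτ : ∀ a, ‖(b' a : ℂ)‖ ≤ |b' a| := fun a => by rw [Complex.norm_real, Real.norm_eq_abs]
  have hρ : ∀ a, ‖(w₁ a : ℂ)‖ ≤ |w₁ a| := fun a => by rw [Complex.norm_real, Real.norm_eq_abs]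
  have hσ : ∀ a, ‖(b a : ℂ)‖ ≤ |b a| := fun a => by rw [Complex.norm_real, Real.norm_eq_abs]
  obtain ⟨N₃, hN₃1, -, hbd⟩ := kltc_tower_compose_fwd C₀ C₁ X Y M' N M₀ (fun p => (b' p : ℂ)) (fun p => (w₁ p : ℂ))
    (fun p => (b p : ℂ)) (fun a => |b' a|) (fun a => |w₁ a|) (fun a => |b a|) R' Ea ER E₁ E₂ hm hr' heR he₁ (hC₀ Qm) hτ hρ hσ hM' gR'
    hR'e hN gEa hM₀ gER hERe hE₁ hE₁e hE₂ hsm₀ hsm₁ hsm₂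
  have hfun : (fun p => ((w₁ p + b p - b' p : ℝ) : ℂ)) = fun a => (w₁ a : ℂ) + (b a : ℂ) - (b' a : ℂ) := by
    funext p; push_cast; ring
  refine ⟨fun p => w₁ p + b p - b' p, hmass, hneg, N₃, ?_, fun k hk k' hk' => ?_⟩
  · rw [hfun]; exact hN₃1
  · have h := hbd k k'
    rw [hC₁_def, hC_on n k hk k' hk'] at h
    exact h.trans (hbud k hk k' hk')

end Model

end Summit.HubbardSuperconductivity.HubbardSuperconductivity.Theorems.KLRegimeSplit

end
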